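import Summits.AnomalousDissipation.AnomalousDissipation.Theorems.SolenoidalFractalHomogenisationLagrangianStepVmodLossAdjDuality
import Summits.AnomalousDissipation.AnomalousDissipation.Theorems.SolenoidalFractalHomogenisationLagrangianStepVmodFrameDefsJD
import Summits.AnomalousDissipation.AnomalousDissipation.Theorems.SolenoidalFractalHomogenisationLagrangianStepLossCurrency
import HarnessLib

/-!
# K1L_D (stmt-AnomalousDissipation-27980), (ℓ3-A) road A, (S2-adj) glue: the PINNED adjoint witness of `EnergyDuhamelG` — duality on a GIVEN
# witness, and the PIN TRANSFER `∫⟪Ψ σ, v⟫ = ⟪φ, T (t₀−σ) t₀ [v]⟫` that moves a non-admissible direction into the datum slot of the forward member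
(helper; `--supports 27980 --as helper`; prover ad-k1loc-p3 g12; memo `HOME/ad-k1loc-p3/S2-NOTE-p3g12.md` §2 «PIN TRICK».)

CONVENTION (D28-8′): derivative-index distortion `Torus.Visc4.conj`; constraint `∇·(G v) = 0`.

WHY.  `EnergyIdGAdj.exists_witness_duality` (p730365) re-obtains an ANONYMOUS witness from the binder, so its conclusions cannot be combined with
the pin clause of `EnergyDuhamelG` (p730003), which speaks about THE witness it hands out.  This file states the a.e. variational lower bound for a
GIVEN distorted weak solution with an `L²` weak gradient (§1, any tensor / carrier / frame family — so it serves the forward member too), and then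
packages, for the pinned adjoint witness `(Ψ, DΨ)` of `hED : EnergyDuhamelG Tw 𝔸U 𝔸T bU G U T` at `(t₀, φ)`:
* §1 **`ae_duality_of_witness`** — for a.e. `σ`: `ψ σ ∈ L²`, `Dψ σ c ∈ L²`, and `λ·A_σ(χ) − λ²·Q_σ(χ) ≤ D(σ)` for every smooth `χ`, every `λ`
  (tensor `𝔸'`, frames `G' σ`; `A_σ(χ) = −∫⟪ψ σ, 𝓛^{(𝔸'ᵀ)^{G'σ},*}χ⟫ − ∫⟪ψ σ, 𝓛^{𝔸'^{G'σ},*}χ⟫`);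
* §2 **`ae_pin_transfer`** — from the pin `toLp (Ψ σ) = (T (t₀−σ) t₀)† φ` a.e. and the contraction property of `T`: for a.e. `σ`, for EVERY `v ∈ L²`,
  `∫⟪Ψ σ x, v x⟫ = ⟪φ, T (t₀−σ) t₀ (toLp v)⟫` and `‖toLp (Ψ σ)‖ ≤ ‖φ‖` — the adjoint state tested against an ARBITRARY (non-admissible) direction is
  the forward coarse propagator applied to that direction as a DATUM, tested against the admissible `φ`;
* §3 **`EnergyDuhamelG.exists_adjWitness_pin_duality`** — the package: witness, class, `L²` gradient, weak partials, the loss formula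
  `lossAdj (T s t₀) φ = 2∫_{(0,t₀−s]} D` for every `s ∈ [0,t₀)`, and a.e. in `σ`: pin transfer + norm bound + scaled duality.
`sorry`-free; NOT a proof of any block, of K1L_D or of AD; rung F-D1.A0.
-/

set_option linter.dupNamespace false

noncomputable section

namespace Summit.AnomalousDissipation.AnomalousDissipation.Theorems.SolenoidalFractalHomogenisation.LagrangianStep.VmodDist

open Literature.Analysis Literature.Analysis.FluidPDE Literature.Analysis.FunctionSpaces
open MeasureTheory Set Filter Function
open scoped ENNReal NNReal InnerProductSpace
open Summit.AnomalousDissipation.AnomalousDissipation.Theorems.SolenoidalFractalHomogenisation.LagrangianStep.CellClauseMod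
open Summit.AnomalousDissipation.AnomalousDissipation.Theorems.SolenoidalFractalHomogenisation.LagrangianStep.CellEnergyT
open Summit.AnomalousDissipation.AnomalousDissipation.Theorems.SolenoidalFractalHomogenisation.LagrangianStep.LossCurrency

/-! ## §1 The a.e. variational lower bound on a GIVEN witness -/

/-- **Duality on a given witness.**  A distorted weak solution `ψ` (tensor `𝔸'`, frames `G' σ` with smooth entries) with an `L²` weak gradient `Dψ` on
the slab `(0,L)` satisfies, for a.e. `σ ∈ (0,L)`: `ψ σ ∈ L²`, `Dψ σ c ∈ L²`, and for every smooth `χ` and real `λ`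
`λ·(−∫⟪ψ σ, 𝓛^{(𝔸'ᵀ)^{G'σ},*}χ⟫ − ∫⟪ψ σ, 𝓛^{𝔸'^{G'σ},*}χ⟫) − λ²·∫Σ 𝔸'^{G'σ} ∂χ∂χ ≤ ∫Σ 𝔸'^{G'σ} (Dψ σ)(Dψ σ)`, provided the quadratic form of `𝔸'`
is fully nonnegative. -/
theorem ae_duality_of_witness {A L : ℝ} {𝔸' : Torus.Visc4 (Fin 3)} {b' : ℝ → VF} {G' : ℝ → UnitAddTorus (Fin 3) → Matrix (Fin 3) (Fin 3) ℝ}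
    {ψ₀ : VF} {ψ : ℝ → VF} {Dψ : ℝ → Fin 3 → VF}
    (hcl : Torus.IsWeakTensorPassiveVectorDistortedOn A L 𝔸' b' G' ψ₀ ψ)
    (hM : ∀ c, MemLp (uncurry (Dψ · c)) 2 (((volume : Measure ℝ).restrict (Ioo 0 L)).prod volume))
    (hD : ∀ᵐ σ ∂(volume.restrict (Ioo 0 L)), ∀ c, Torus.HasWeakPartialDeriv c (ψ σ) (Dψ σ c))
    (hGs : ∀ σ i j, Torus.IsSmooth (fun y => G' σ y i j))
    (hQ : ∀ ξ : Fin 3 → Fin 3 → ℝ, 0 ≤ ∑ l, ∑ i, ∑ c, ∑ e, 𝔸' i c l e * ξ c i * ξ e l) :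
    ∀ᵐ σ ∂(volume.restrict (Ioo 0 L)), MemLp (ψ σ) 2 volume ∧ (∀ c, MemLp (Dψ σ c) 2 volume) ∧
      ∀ χ : VF, Torus.IsSmooth χ → ∀ lam : ℝ,
        lam * (-(∫ x, ⟪ψ σ x, Torus.viscAdjVar (fun y => Torus.Visc4.conj (G' σ y) (Torus.majorTranspose 𝔸')) χ x⟫_ℝ)
                - ∫ x, ⟪ψ σ x, Torus.viscAdjVar (fun y => Torus.Visc4.conj (G' σ y) 𝔸') χ x⟫_ℝ)
            - lam ^ 2 * ∫ x, ∑ l, ∑ i, ∑ c, ∑ e, Torus.Visc4.conj (G' σ x) 𝔸' i c l e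
                * (Torus.partialDeriv c χ x) i * (Torus.partialDeriv e χ x) l
          ≤ ∫ x, ∑ l, ∑ i, ∑ c, ∑ e, Torus.Visc4.conj (G' σ x) 𝔸' i c l e * (Dψ σ c x) i * (Dψ σ e x) l := by
  have hψ2 := hcl.ae_memLp_two
  have hD2 : ∀ᵐ σ ∂(volume.restrict (Ioo 0 L)), ∀ c, MemLp (Dψ σ c) 2 volume := ae_all_iff.2 fun c => ae_memLp_two_slice (hM c)
  filter_upwards [hψ2, hD2, hD] with σ h1 h2 h3
  refine ⟨h1, h2, fun χ hχ lam => ?_⟩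
  have h𝔹 : ∀ i c l e, Torus.IsSmooth (fun y => Torus.Visc4.conj (G' σ y) 𝔸' i c l e) :=
    fun i c l e => isSmooth_conj_field (hGs σ) _ i c l e
  have hQ' : ∀ y (ξ : Fin 3 → Fin 3 → ℝ), 0 ≤ ∑ l, ∑ i, ∑ c, ∑ e, Torus.Visc4.conj (G' σ y) 𝔸' i c l e * ξ c i * ξ e l :=
    fun y ξ => (quadForm_conj_nonneg hQ (G' σ y) ξ).1
  have key := integral_quadForm_ge_duality_smul h𝔹 hQ' h1 h2 h3 hχ lam
  have e : (fun y => Torus.majorTranspose (Torus.Visc4.conj (G' σ y) 𝔸')) = fun y => Torus.Visc4.conj (G' σ y) (Torus.majorTranspose 𝔸') := by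
    funext y; rw [Torus.Visc4.conj_majorTranspose]
  rw [e] at key
  exact key

/-! ## §2 The pin transfer -/

variable {Tw : ℝ} {𝔸U 𝔸T : Torus.Visc4 (Fin 3)} {bU : ℝ → VF} {G : ℝ → UnitAddTorus (Fin 3) → Matrix (Fin 3) (Fin 3) ℝ}
  {U T : ℝ → ℝ → (V2 →L[ℝ] V2)}

/-- The `L²` pairing of two representatives is the inner product of their classes. -/
theorem integral_inner_eq_inner_toLp {f g : VF} (hf : MemLp f 2 volume) (hg : MemLp g 2 volume) :
    ∫ x, ⟪f x, g x⟫_ℝ = ⟪hf.toLp f, hg.toLp g⟫_ℝ := by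
  rw [L2.inner_def]
  exact integral_congr_ae (by
    filter_upwards [hf.coeFn_toLp, hg.coeFn_toLp] with x hx hy
    rw [hx, hy])

/-- **PIN TRANSFER.**  If `Ψ σ` represents `(T (t₀−σ) t₀)† φ` for a.e. `σ` and `T` is a contraction, then for a.e. `σ`: for EVERY `v ∈ L²`
`∫⟪Ψ σ x, v x⟫ = ⟪φ, T (t₀−σ) t₀ (toLp v)⟫` (adjoint), and `‖toLp (Ψ σ)‖ ≤ ‖φ‖`. -/
theorem ae_pin_transfer {t₀ : ℝ} {φ : V2} {Ψ : ℝ → VF} (hT : ∀ s t (y : V2), ‖T s t y‖ ≤ ‖y‖)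
    (hpin : ∀ᵐ σ ∂(volume.restrict (Ioo 0 t₀)), ∃ hσ : MemLp (Ψ σ) 2 volume,
      hσ.toLp (Ψ σ) = ContinuousLinearMap.adjoint (T (t₀ - σ) t₀) φ) :
    ∀ᵐ σ ∂(volume.restrict (Ioo 0 t₀)), ∃ hσ : MemLp (Ψ σ) 2 volume,
      ‖hσ.toLp (Ψ σ)‖ ≤ ‖φ‖ ∧
      ∀ (v : VF) (hv : MemLp v 2 volume), ∫ x, ⟪Ψ σ x, v x⟫_ℝ = ⟪φ, T (t₀ - σ) t₀ (hv.toLp v)⟫_ℝ := by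
  filter_upwards [hpin] with σ hσ
  obtain ⟨hm, he⟩ := hσ
  refine ⟨hm, ?_, fun v hv => ?_⟩
  · rw [he]; exact norm_adjoint_le (hT _ _) φ
  · rw [integral_inner_eq_inner_toLp hm hv, he, ContinuousLinearMap.adjoint_inner_left]

/-! ## §3 The package for the pinned adjoint witness of `EnergyDuhamelG` -/

/-- **The pinned adjoint witness with pin transfer and duality.**  Under `hED : EnergyDuhamelG Tw 𝔸U 𝔸T bU G U T`, a contraction `T`, smooth frame
slices and full nonnegativity of the quadratic form of `𝔸T`: for `0 < t₀ ≤ Tw` and a `G(t₀)`-solenoidal `φ`, the adjoint witness `(Ψ, DΨ)` of the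
COARSE member with (i) its class membership, `L²` gradient and weak partials, (ii) `lossAdj (T s t₀) φ = 2∫_{(0,t₀−s]} D(σ)` for every `s ∈ [0,t₀)`,
`D(σ) = ∫Σ(𝔸Tᵀ)^{G(t₀−σ)}(DΨ σ)(DΨ σ)`, and (iii) for a.e. `σ ∈ (0,t₀)`: `‖toLp (Ψ σ)‖ ≤ ‖φ‖`, the PIN TRANSFER `∫⟪Ψ σ, v⟫ = ⟪φ, T (t₀−σ) t₀ (toLp v)⟫`
for every `v ∈ L²`, `DΨ σ c ∈ L²`, and the scaled duality `λ·A_σ(χ) − λ²·Q_σ(χ) ≤ D(σ)` for every smooth `χ`, every `λ`. -/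
theorem EnergyDuhamelG.exists_adjWitness_pin_duality (hED : EnergyDuhamelG Tw 𝔸U 𝔸T bU G U T)
    (hT : ∀ s t (y : V2), ‖T s t y‖ ≤ ‖y‖) (hGs : ∀ t i j, Torus.IsSmooth (fun y => G t y i j))
    (hQ : ∀ ξ : Fin 3 → Fin 3 → ℝ, 0 ≤ ∑ l, ∑ i, ∑ c, ∑ e, 𝔸T i c l e * ξ c i * ξ e l)
    {t₀ : ℝ} (ht₀ : 0 < t₀) (ht₀T : t₀ ≤ Tw) (φ : V2) (hφ : Torus.IsWeaklyDivFree (Torus.distort (G t₀) ((φ : V2) : VF))) :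
    ∃ (Ψ : ℝ → VF) (DΨ : ℝ → Fin 3 → VF),
      Torus.IsWeakTensorPassiveVectorDistortedOn 0 t₀ (Torus.majorTranspose 𝔸T) (revCarrier (fun _ _ => 0) t₀) (fun σ => G (t₀ - σ))
        ((φ : V2) : VF) Ψ ∧
      (∀ c, MemLp (uncurry (DΨ · c)) 2 (((volume : Measure ℝ).restrict (Ioo 0 t₀)).prod volume)) ∧
      (∀ᵐ σ ∂(volume.restrict (Ioo 0 t₀)), ∀ c, Torus.HasWeakPartialDeriv c (Ψ σ) (DΨ σ c)) ∧
      (∀ s ∈ Ico 0 t₀, lossAdj (T s t₀) φ =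
        2 * ∫ σ in Ioc 0 (t₀ - s), ∫ x, ∑ l, ∑ i, ∑ c, ∑ e,
          Torus.Visc4.conj (G (t₀ - σ) x) (Torus.majorTranspose 𝔸T) i c l e * (DΨ σ c x) i * (DΨ σ e x) l) ∧
      ∀ᵐ σ ∂(volume.restrict (Ioo 0 t₀)),
        (∃ hσ : MemLp (Ψ σ) 2 volume, ‖hσ.toLp (Ψ σ)‖ ≤ ‖φ‖ ∧
          ∀ (v : VF) (hv : MemLp v 2 volume), ∫ x, ⟪Ψ σ x, v x⟫_ℝ = ⟪φ, T (t₀ - σ) t₀ (hv.toLp v)⟫_ℝ) ∧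
        (∀ c, MemLp (DΨ σ c) 2 volume) ∧
        ∀ χ : VF, Torus.IsSmooth χ → ∀ lam : ℝ,
          lam * (-(∫ x, ⟪Ψ σ x, Torus.viscAdjVar (fun y => Torus.Visc4.conj (G (t₀ - σ) y) 𝔸T) χ x⟫_ℝ)
                  - ∫ x, ⟪Ψ σ x, Torus.viscAdjVar (fun y => Torus.Visc4.conj (G (t₀ - σ) y) (Torus.majorTranspose 𝔸T)) χ x⟫_ℝ)
              - lam ^ 2 * ∫ x, ∑ l, ∑ i, ∑ c, ∑ e, Torus.Visc4.conj (G (t₀ - σ) x) (Torus.majorTranspose 𝔸T) i c l e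
                  * (Torus.partialDeriv c χ x) i * (Torus.partialDeriv e χ x) l
            ≤ ∫ x, ∑ l, ∑ i, ∑ c, ∑ e,
                Torus.Visc4.conj (G (t₀ - σ) x) (Torus.majorTranspose 𝔸T) i c l e * (DΨ σ c x) i * (DΨ σ e x) l := by
  obtain ⟨Ψ, DΨ, hpin, hcl, hM, hD, hE, _⟩ := hED t₀ ht₀ ht₀T φ hφ
  refine ⟨Ψ, DΨ, hcl, hM, hD, fun s hs => ?_, ?_⟩
  · unfold lossAdj; rw [hE s hs]; ring
  · have hQ' : ∀ ξ : Fin 3 → Fin 3 → ℝ, 0 ≤ ∑ l, ∑ i, ∑ c, ∑ e, Torus.majorTranspose 𝔸T i c l e * ξ c i * ξ e l :=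
      fun ξ => by rw [quadForm_majorTranspose]; exact hQ ξ
    have hdual := ae_duality_of_witness hcl hM hD (fun σ i j => hGs (t₀ - σ) i j) hQ'
    have hpt := ae_pin_transfer hT hpin
    filter_upwards [hdual, hpt] with σ h1 h2
    refine ⟨h2, h1.2.1, fun χ hχ lam => ?_⟩
    have h := h1.2.2 χ hχ lam
    simpa only [Torus.majorTranspose_majorTranspose] using h

end Summit.AnomalousDissipation.AnomalousDissipation.Theorems.SolenoidalFractalHomogenisation.LagrangianStep.VmodDist

end
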